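import Summits.BirchSwinnertonDyer.BirchSwinnertonDyer.Theorems.ByReductionTypeAtTwoRankOneAtTwoBigImageOddLocalOneDoorHalvesKNamed
import Summits.BirchSwinnertonDyer.BirchSwinnertonDyer.Theorems.ByReductionTypeAtTwoRankOneAtTwoBigImageOddLocalOneDoorHalvesAssembly
import HarnessLib

/-!
# Route ByReductionTypeAtTwo, crux `RankOneAtTwoBigImageOddLocal` (stmt-BirchSwinnertonDyer-23715), LINE v8.6 `one_door_analytic`:
# the two load-bearing stubs FROM THE REGISTERED STUBS OF `KolyvaginExactAtTwo` (stmt-BirchSwinnertonDyer-22137) BY TYPE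

Lead prover seat `bsd-line-fkl-p1` g10 (2026-08-28), `--supports stmt-BirchSwinnertonDyer-23715`.  THEOREMS ONLY; conditional by
design; nothing is asserted; BSD is not proved by any of this.

The skeleton of record (v8.6) concludes the crux from `stub_pub4` (PRINT), `stub_doorUpperC : S_pub4 → DoorIndexLawUpperCAtTwo`
(AN-28c-U, the Euler-system half), `stub_doorLowerC : S_pub4 → DoorIndexLawLowerCAtTwo` (AN-28c-L, the converse half) and
`stub_rankZeroAtTwo` (this route's four rank-`0` cruxes BY NAME).  Route GenusKolyvaginAtTwo's crux `KolyvaginExactAtTwo`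
(stmt-22137, lead `bsd-line-gk2-p1/p2`) carries two REGISTERED stubs (skeleton 2026-08-27T23:59Z):

* `stub_upperBoundAtTwo` — Kolyvagin's UPPER bound at `2` over `K` with the sharp exponent and NO Kolyvagin-conjecture input:
  for `W/ℚ` globally minimal non-CM with `ρ_{W,2^n}` onto (`n ≥ 1`), `K` imaginary quadratic with odd `d_K ≠ −3`, the Heegner
  hypothesis and `d_K·(−|Δ|)`, `d_K·(−2|Δ|)` non-squares, ANY datum `Dt`, `β`, `ι`, conductor-`1` datum `d₁` with `y_K = P(1)` of
  infinite order and `2^{M₀+1} ∤ y_K` in `E(K[1])`: `#Ш(E_K)[2^∞] ∣ 2^{2M₀}` (c-free: sharp exactly at odd-constant data);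
* `stub_lowerBoundAtTwo` — the reverse divisibility `2^{2M₀} ∣ #Ш(E_K)[2^∞]` given `2^{M₀} ∣ y_K` and a `2`-INDIVISIBLE derived
  point `P(n)` at a square-free product `n` of Kolyvagin primes at `2` (McCallum's structure theorem at `2` in the `m_∞ = 0` case).

This file takes those two statements VERBATIM as binders (`hKU`, `hKL` — so the sibling lead's theorems apply by name the moment
they land) and proves:

* §0 `exists_oddConstant_kolyvaginDoorDatum_of_onSlice` — the width seat's frame `exists_kolyvaginDoorDatum_of_onSlice` (p627493)
  with the datum taken from `S_manin` (odd constant): for `W` on the slice, a Kolyvagin-admissible Hoffstein–Luo door `K`, an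
  ODD-constant `Dt`, `β`, `ι`, the proved conductor-`1` datum, `y_K` of infinite order (Gross–Zagier) and its exact exponent `M₀`.
* §1 **`doorIndexLawUpperCAtTwo_of_kolyvaginUpperBoundAtTwoK_of_manin`: AN-28c-U (= `stub_doorUpperC`'s conclusion) from `hKU`
  + `S_manin` + PRINT (Gross–Zagier, Kolyvagin, GZK, modularity as a newform, Hoffstein–Luo 1997, Milne 1972) + `S_rankZeroTwin`.**
  Mechanism: at the odd-constant datum `hKU` gives `#Ш(E_K)[2^∞] = 2^j`, `j ≤ 2M₀`, i.e. the width seat's c-corrected `≤`-binder at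
  ONE datum; `missingUpperBoundAt_two_of_shaUpperC_at` (p627493) turns it into Miller's upper half of `BSD₂(W)`, and the lead's
  `doorIndexLawUpperCAtTwo_of_missingUpperBoundAt_onSlice` (p628851) into AN-28c-U at EVERY door datum of `W` (any constant).
* §2 `doorIndexLawLowerCAtTwo_of_kolyvaginBoundsAtTwoK_of_kolyvaginConjecture_of_manin` — AN-28c-L from `hKU`, `hKL`, `S_manin`,
  the same PRINT, `S_rankZeroTwin` and `hKC` = KOLYVAGIN'S CONJECTURE AT `2` on the slice's doors in derived-point form (the binder of
  the width seat's `rankOneAtTwoBigImageOddLocal_of_kolyvaginExactAtTwo_of_kolyvaginConjecture`, p622543, VERBATIM): at the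
  odd-constant datum the two stubs pin `#Ш(E_K)[2^∞] = 2^{2M₀}`.
* §3 `rankOneAtTwoBigImageOddLocal_of_kolyvaginBoundsAtTwoK_of_kolyvaginConjecture_of_manin` — the crux BY NAME from PRINT, the two
  K-side stubs, `hKC`, `S_manin` and this route's four rank-`0` cruxes (through the v8.6 composition
  `rankOneAtTwoBigImageOddLocal_of_oneDoorAnalyticC_halves`, p628086).

Net for the planners (lead report G10): **the Euler-system half of 23715 is NOT a new crux** — it is route GenusKolyvaginAtTwo's
registered `stub_upperBoundAtTwo` plus the odd-constant supply `S_manin` (= PRINT `S_maninPub` at `4 ∤ N`, `@[conjecture]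
ManinOddAdditiveLevelAtTwo` at `4 ∣ N`, `s_manin_of`, p611607-era) — kernel implication below; the converse half is
`stub_lowerBoundAtTwo` plus Kolyvagin's conjecture at `2` on the slice (no item supplies the latter for rank-one curves).  The sign
split of 22137 (items 24880/24882 on `Δ < 0`, residual 24883 on `Δ > 0`) is inherited by `stub_doorUpperC` through this file.

References: [GrossLMS1991] Thm. 1.3, §2 Conj. (2.2), §4; [McCallumLMS1991] §5; [KolyvaginEulerSystems1990] Thm. A;
[Milne1972ArithmeticAV] §1 Thm. 1; [Cesnavicius2018] Thm. 1.2; [Miller2011LMS] Def. 1.1.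
-/

set_option autoImplicit false
-- the Theorems namespace of this sub repeats the summit name by design (D-0017 nested layout)
set_option linter.dupNamespace false

noncomputable section

open scoped Classical

namespace Summit.BirchSwinnertonDyer.BirchSwinnertonDyer.Theorems.RankOneAtTwoOneDoor

open WeierstrassCurve NumberField Literature.NumberTheory.EllipticCurves Literature.NumberTheory.EllipticCurves.ModularForms
  Literature.NumberTheory.EllipticCurves.Rank1Residual
  Literature.NumberTheory.EllipticCurves.Rank1Residual.Typed
  Literature.NumberTheory.EllipticCurves.KrizLi2019
  Summit.BirchSwinnertonDyer.Rank1Residual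
  Summit.BirchSwinnertonDyer.Rank1Residual.AdditivePotMult
  Summit.BirchSwinnertonDyer.Rank1Residual.F1Sign2
  Summit.BirchSwinnertonDyer.Rank1Residual.F1Sign2.TranspositionDoor
  Summit.BirchSwinnertonDyer.BirchSwinnertonDyer.Theses.ByReductionTypeAtTwo
  Summit.BirchSwinnertonDyer.BirchSwinnertonDyer.Theorems.CMExactDescent

/-! ### §0 The odd-constant Kolyvagin–Heegner frame on the slice -/

/-- **The odd-constant frame.**  For `W/ℚ` globally minimal with odd torsion order and analytic rank `1`, modulo Gross–Zagier
(`hGZ`), modularity as a newform (`hnf`), Hoffstein–Luo 1997 (`hHL`) and the odd-constant supply `S_manin` (`hMan`): a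
Kolyvagin-admissible door field `K` (odd `d_K ≠ −3`, Heegner hypothesis, `d_K·(−|Δ|)` and `d_K·(−2|Δ|)` non-squares), a datum `Dt`
with ODD constant, `β`, `ι`, a conductor-`1` Kolyvagin–Heegner datum `d₁` whose `y_K = P(1)` has infinite order, and its exact
`2`-divisibility exponent `M₀` in `E(K[1])`.  (The width seat's `exists_kolyvaginDoorDatum_of_onSlice` with the datum from `S_manin`.)
[cite: GrossZagier1986, V.§2] [cite: GrossLMS1991, §4] [cite: Cesnavicius2018, Thm. 1.2] -/
theorem exists_oddConstant_kolyvaginDoorDatum_of_onSlice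
    (hGZ : ∀ (N : ℕ) [NeZero N] (W : WeierstrassCurve ℚ) (K : Type) [Field K] [NumberField K], gross_zagier N W K)
    (hnf : exists_isNewformOf) (hHL : HoffsteinLuo1997_exists_twist_L_one_ne_zero) (hMan : S_manin)
    (W : WeierstrassCurve ℚ) [W.IsElliptic] [W.IsGloballyMinimal] [NeZero (W.conductorNorm ℤ)]
    (hT : Odd W.torsionOrder) (hr : W.analyticRank = 1) :
    ∃ (K : Type) (_ : Field K) (_ : NumberField K), IsImaginaryQuadratic K ∧ Odd (NumberField.discr K) ∧
      NumberField.discr K ≠ -3 ∧ SatisfiesHeegnerHypothesis (W.conductorNorm ℤ) K ∧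
      ¬ IsSquare ((NumberField.discr K : ℚ) * -|W.Δ|) ∧ ¬ IsSquare ((NumberField.discr K : ℚ) * (-(2 * |W.Δ|))) ∧
      ∃ (Dt : ModularParametrizationData W (W.conductorNorm ℤ)) (β : ℤ) (ι : K →+* ℂ) (d₁ : KolyvaginHeegnerData Dt β ι 1)
        (M₀ : ℕ), Odd Dt.c ∧ ¬ IsOfFinAddOrder d₁.derivedPoint ∧
        (∃ Q : (W.baseChange (ringClassField K ι 1)).toAffine.Point, ((2 ^ M₀ : ℕ) : ℤ) • Q = d₁.derivedPoint) ∧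
        ¬ ∃ Q : (W.baseChange (ringClassField K ι 1)).toAffine.Point, ((2 ^ (M₀ + 1) : ℕ) : ℤ) • Q = d₁.derivedPoint := by
  have hmod : hasEntireLFunction_rat := hasEntireLFunction_rat_of_exists_isNewformOf hnf
  obtain ⟨K, _iF, _iN, hK, hodd, h3, hH, hsq1, hsq2, -, hLt, -⟩ :=
    exists_kolyvaginDoorField_of_analyticRank_eq_one hnf hHL W hr
  -- the odd-constant datum from `S_manin` (no rational `2`-torsion from odd torsion order)
  have hT2 : NoRationalTwoTorsion W := noRationalTwoTorsion_of_odd_torsionOrder W hT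
  obtain ⟨Dt, hc2⟩ := hMan W hT2
  have hcM : Odd Dt.c := Int.not_even_iff_odd.mp fun h => hc2 (even_iff_two_dvd.mp h)
  obtain ⟨β, hβ⟩ : ∃ β : ℤ, (4 * (W.conductorNorm ℤ : ℕ) : ℤ) ∣ β ^ 2 - NumberField.discr K :=
    Literature.NumberTheory.QuadraticFields.Quadratic.exists_dvd_sq_sub_discr_of_ncard_primesOver hK.1 (NeZero.ne _) hH
  obtain ⟨ι⟩ : Nonempty (K →+* ℂ) := inferInstance
  obtain ⟨d₁⟩ := exists_kolyvaginHeegnerData_one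
    (phi_heegnerTau_mem_singularModuliField_holds (W.conductorNorm ℤ) W K) hK Dt β ι hβ
  -- `y_K` has infinite order: `L'(W/K, 1) = L'(W, 1) · L(W^{(d_K)}, 1) ≠ 0` and Gross–Zagier
  haveI hEK : (W.baseChange K).IsElliptic := isElliptic_baseChange' W K
  have hL0 : W.entireLFunction 1 = 0 := entireLFunction_one_eq_zero_of_analyticRank_eq_one hr
  obtain ⟨-, hderiv⟩ := leadingLCoeff_eq_deriv_of_analyticRank_eq_one hr
  have hLK : LDerivEK W K ≠ 0 := by
    rw [lDerivEK_eq_deriv_mul W K hmod hL0]; exact mul_ne_zero hderiv hLt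
  obtain ⟨P₀, Hd, hP₀, hP₀K⟩ := exists_heegnerPoint_map_eq_derivedPoint_one hK hH d₁
  have hP₀inf : ¬ IsOfFinAddOrder P₀ :=
    (lDerivEK_ne_zero_iff_not_isOfFinAddOrder W (W.conductorNorm ℤ) K (hGZ _ W K) hK hH ⟨Dt, Hd, ι, hP₀⟩).mp hLK
  have hy : ¬ IsOfFinAddOrder d₁.derivedPoint := by
    intro hfin
    apply hP₀inf
    rw [← hP₀K] at hfin
    exact (WeierstrassCurve.Affine.Point.map_injective (W' := W) _).isOfFinAddOrder_iff.mp hfin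
  -- `M₀ = ord₂(y_K)` in `E(K[1])` (finite generation)
  obtain ⟨M₀, hdiv, hndiv⟩ : ∃ M₀ : ℕ,
      (∃ Q : (W.baseChange (ringClassField K ι 1)).toAffine.Point, ((2 ^ M₀ : ℕ) : ℤ) • Q = d₁.derivedPoint) ∧
      ¬ ∃ Q : (W.baseChange (ringClassField K ι 1)).toAffine.Point, ((2 ^ (M₀ + 1) : ℕ) : ℤ) • Q = d₁.derivedPoint := by
    haveI : NumberField (ringClassField K ι 1) := numberField_ringClassField hK ι one_ne_zero
    haveI : (W.baseChange (ringClassField K ι 1)).IsElliptic := by rw [baseChange]; infer_instance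
    haveI : Module.Finite ℤ (W.baseChange (ringClassField K ι 1)).toAffine.Point := by
      convert (W.baseChange (ringClassField K ι 1)).module_finite_point_holds
    exact exists_pow_smul_eq_and_not_of_not_isOfFinAddOrder Nat.prime_two hy
  exact ⟨K, _iF, _iN, hK, hodd, h3, hH, hsq1, hsq2, Dt, β, ι, d₁, M₀, hcM, hy, hdiv, hndiv⟩

/-- From the tower hypothesis of the slice (`ρ_{W,2^n}` onto for every `n`, level cast `((2^n : ℕ) : ℤ)`) to route
GenusKolyvaginAtTwo's form (`n ≥ 1`, level `(2 : ℤ)^n`). [folklore] -/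
theorem hasSurjectiveModNGaloisRep_two_pow_of_tower (W : WeierstrassCurve ℚ) [W.IsElliptic]
    (hsurj : ∀ n : ℕ, W.HasSurjectiveModNGaloisRep ((2 ^ n : ℕ) : ℤ)) :
    ∀ n : ℕ, 0 < n → W.HasSurjectiveModNGaloisRep ((2 : ℤ) ^ n) := by
  intro n _
  have h := hsurj n
  push_cast at h
  exact h

/-! ### §1 The Euler-system half AN-28c-U from `stub_upperBoundAtTwo` of 22137 and the odd-constant supply -/

/-- **THE EULER-SYSTEM HALF OF `BSD₂` ON THE WHOLE SLICE OF 23715 FROM ROUTE GenusKolyvaginAtTwo's REGISTERED `stub_upperBoundAtTwo`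
(binder `hKU`, VERBATIM: Kolyvagin's upper bound at `2` over `K`, sharp exponent, no Kolyvagin-conjecture input, c-free) and the
odd-constant supply `S_manin`**, modulo PRINT (Gross–Zagier `hGZ`, GZK `hGZK`, modularity as a newform `hnf`, Hoffstein–Luo 1997
`hHL`, Milne 1972 `hMilneC`) and rank-`0` `BSD₂` of non-CM curves (`S_rankZeroTwin`): `ord₂ #Ш(W) ≤ ord₂ #Ш_an(W)`
(`MissingUpperBoundAt W 2`) for every non-CM globally minimal `W` with `ρ_{W,2^n}` onto for all `n`, odd torsion, odd Tamagawa
product and analytic rank `1`.  At the odd-constant datum of §0, `hKU` reads `#Ш(E_K)[2^∞] = 2^j` with `j ≤ 2M₀`, which is the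
c-corrected `≤`-binder of `missingUpperBoundAt_two_of_shaUpperC_at` at that ONE datum.  Conditional by design; BSD is not proved by this.
[cite: GrossLMS1991, Thm. 1.3 and §4] [cite: KolyvaginEulerSystems1990, Thm. A] [cite: Milne1972ArithmeticAV, §1 Thm. 1] -/
theorem missingUpperBoundAt_two_onSlice_of_kolyvaginUpperBoundAtTwoK_of_manin
    (hGZ : ∀ (N : ℕ) [NeZero N] (W : WeierstrassCurve ℚ) (K : Type) [Field K] [NumberField K], gross_zagier N W K)
    (hGZK : rank_eq_analyticRank_of_analyticRank_le_one) (hnf : exists_isNewformOf)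
    (hHL : HoffsteinLuo1997_exists_twist_L_one_ne_zero) (hMilneC : Milne1972.bsdQuotient_baseChange_quadratic_anyModel)
    (hMan : S_manin)
    (hKU : ∀ (W : WeierstrassCurve ℚ) [W.IsElliptic] [W.IsGloballyMinimal] [NeZero (W.conductorNorm ℤ)], ¬ W.HasCM →
      ∀ (K : Type) [Field K] [NumberField K], IsImaginaryQuadratic K → Odd (NumberField.discr K) →
        NumberField.discr K ≠ -3 → SatisfiesHeegnerHypothesis (W.conductorNorm ℤ) K →
        ¬ IsSquare ((NumberField.discr K : ℚ) * -|W.Δ|) → ¬ IsSquare ((NumberField.discr K : ℚ) * (-(2 * |W.Δ|))) →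
        (∀ n : ℕ, 0 < n → W.HasSurjectiveModNGaloisRep ((2 : ℤ) ^ n)) →
        ∀ (Dt : ModularParametrizationData W (W.conductorNorm ℤ)) (β : ℤ) (ι : K →+* ℂ) (d₁ : KolyvaginHeegnerData Dt β ι 1),
          ¬ IsOfFinAddOrder d₁.derivedPoint → ∀ (M₀ : ℕ),
          (¬ ∃ Q : (W.baseChange (ringClassField K ι 1)).toAffine.Point, ((2 ^ (M₀ + 1) : ℕ) : ℤ) • Q = d₁.derivedPoint) →
          Nat.card (AddCommGroup.primaryComponent (W.baseChange K).sha 2) ∣ 2 ^ (2 * M₀))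
    (hZ : S_rankZeroTwin) :
    ∀ (W : WeierstrassCurve ℚ) [W.IsElliptic] [W.IsGloballyMinimal], ¬ W.HasCM →
      (∀ n : ℕ, W.HasSurjectiveModNGaloisRep ((2 ^ n : ℕ) : ℤ)) → Odd W.torsionOrder → Odd W.tamagawaProduct →
      W.analyticRank = 1 → MissingUpperBoundAt W 2 := by
  intro W _ _ hCM hsurj hT hc hr
  haveI hN : NeZero (W.conductorNorm ℤ) := ⟨(W.conductorNorm_pos_holds).ne'⟩
  have hmod : hasEntireLFunction_rat := hasEntireLFunction_rat_of_exists_isNewformOf hnf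
  obtain ⟨K, _iF, _iN, hK, hodd, h3, hH, hsq1, hsq2, Dt, β, ι, d₁, M₀, hcM, hy, hdiv, hndiv⟩ :=
    exists_oddConstant_kolyvaginDoorDatum_of_onSlice hGZ hnf hHL hMan W hT hr
  have hsurj' := hasSurjectiveModNGaloisRep_two_pow_of_tower W hsurj
  -- Kolyvagin's upper bound at `2` over `K` at the odd-constant datum
  have hdvd := hKU W hCM K hK hodd h3 hH hsq1 hsq2 hsurj' Dt β ι d₁ hy M₀ hndiv
  obtain ⟨j, hj, hcard⟩ := (Nat.dvd_prime_pow Nat.prime_two).mp hdvd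
  have hv : padicValNat 2 (Nat.card (AddCommGroup.primaryComponent (W.baseChange K).sha 2)) = j := by
    rw [hcard]; exact padicValNat.prime_pow j
  have hc2 : ¬ (2 : ℤ) ∣ Dt.c := fun h => (Int.not_even_iff_odd.mpr hcM) (even_iff_two_dvd.mpr h)
  have hvc : padicValInt 2 Dt.c = 0 := padicValInt.eq_zero_of_not_dvd hc2
  have hshaU : (padicValNat 2 (Nat.card (AddCommGroup.primaryComponent (W.baseChange K).sha 2)) : ℤ) +
      2 * padicValInt 2 Dt.c ≤ 2 * M₀ := by
    rw [hv, hvc]; push_cast; omega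
  exact missingUpperBoundAt_two_of_shaUpperC_at hGZ hGZK hmod hMilneC hZ W hCM hsurj hc hr K hK hodd h3 hH Dt β ι d₁ hy M₀ hdiv
    hndiv hshaU

/-- **AN-28c-U `DoorIndexLawUpperCAtTwo` — the conclusion of the skeleton's `stub_doorUpperC` — FROM ROUTE GenusKolyvaginAtTwo's
REGISTERED `stub_upperBoundAtTwo` OF 22137 (binder `hKU`, verbatim) AND `S_manin`**, modulo PRINT (Gross–Zagier, Kolyvagin, GZK,
modularity as a newform, Hoffstein–Luo 1997, Milne 1972) and `S_rankZeroTwin`: the slice-level Euler-system half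
(`missingUpperBoundAt_two_onSlice_of_kolyvaginUpperBoundAtTwoK_of_manin`) fed to the lead's per-datum converse
`doorIndexLawUpperCAtTwo_of_missingUpperBoundAt_onSlice` (AN-28c-U at EVERY door datum, any constant, every exponent).  So the
Euler-system half of 23715 is the sibling route's registered stub plus the odd-constant supply — not a new crux.  Conditional by
design; BSD is not proved by this.
[cite: GrossLMS1991, Thm. 1.3 and §4] [cite: KolyvaginEulerSystems1990, Thm. A] [cite: Milne1972ArithmeticAV, §1 Thm. 1] -/
theorem doorIndexLawUpperCAtTwo_of_kolyvaginUpperBoundAtTwoK_of_manin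
    (hGZ : ∀ (N : ℕ) [NeZero N] (W : WeierstrassCurve ℚ) (K : Type) [Field K] [NumberField K], gross_zagier N W K)
    (hKo : ∀ (N : ℕ) [NeZero N] (W : WeierstrassCurve ℚ) (K : Type) [Field K] [NumberField K], kolyvagin N W K)
    (hGZK : rank_eq_analyticRank_of_analyticRank_le_one) (hnf : exists_isNewformOf)
    (hHL : HoffsteinLuo1997_exists_twist_L_one_ne_zero) (hMilneC : Milne1972.bsdQuotient_baseChange_quadratic_anyModel)
    (hMan : S_manin)
    (hKU : ∀ (W : WeierstrassCurve ℚ) [W.IsElliptic] [W.IsGloballyMinimal] [NeZero (W.conductorNorm ℤ)], ¬ W.HasCM →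
      ∀ (K : Type) [Field K] [NumberField K], IsImaginaryQuadratic K → Odd (NumberField.discr K) →
        NumberField.discr K ≠ -3 → SatisfiesHeegnerHypothesis (W.conductorNorm ℤ) K →
        ¬ IsSquare ((NumberField.discr K : ℚ) * -|W.Δ|) → ¬ IsSquare ((NumberField.discr K : ℚ) * (-(2 * |W.Δ|))) →
        (∀ n : ℕ, 0 < n → W.HasSurjectiveModNGaloisRep ((2 : ℤ) ^ n)) →
        ∀ (Dt : ModularParametrizationData W (W.conductorNorm ℤ)) (β : ℤ) (ι : K →+* ℂ) (d₁ : KolyvaginHeegnerData Dt β ι 1),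
          ¬ IsOfFinAddOrder d₁.derivedPoint → ∀ (M₀ : ℕ),
          (¬ ∃ Q : (W.baseChange (ringClassField K ι 1)).toAffine.Point, ((2 ^ (M₀ + 1) : ℕ) : ℤ) • Q = d₁.derivedPoint) →
          Nat.card (AddCommGroup.primaryComponent (W.baseChange K).sha 2) ∣ 2 ^ (2 * M₀))
    (hZ : S_rankZeroTwin) : DoorIndexLawUpperCAtTwo :=
  doorIndexLawUpperCAtTwo_of_missingUpperBoundAt_onSlice hGZ hKo hnf hHL
    (missingUpperBoundAt_two_onSlice_of_kolyvaginUpperBoundAtTwoK_of_manin hGZ hGZK hnf hHL hMilneC hMan hKU hZ) hZ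

/-! ### §2 The converse half AN-28c-L from the two stubs of 22137, Kolyvagin's conjecture at `2` and the odd-constant supply -/

/-- **THE MAIN-CONJECTURE HALF OF `BSD₂` ON THE WHOLE SLICE from the two registered stubs of 22137 (`hKU`, `hKL`, verbatim),
Kolyvagin's conjecture at `2` on the slice's doors (`hKC`: derived-point form at odd-constant data, the binder of
`rankOneAtTwoBigImageOddLocal_of_kolyvaginExactAtTwo_of_kolyvaginConjecture` verbatim) and `S_manin`**, modulo PRINT and
`S_rankZeroTwin`: at the odd-constant datum of §0 the two divisibilities pin `#Ш(E_K)[2^∞] = 2^{2M₀}`, the `≥`-binder of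
`missingLowerBoundAt_two_of_shaLowerC_at`.  Conditional by design; BSD is not proved by this.
[cite: GrossLMS1991, §2 Conj. (2.2) and §4] [cite: McCallumLMS1991, §5] [cite: Milne1972ArithmeticAV, §1 Thm. 1] -/
theorem missingLowerBoundAt_two_onSlice_of_kolyvaginBoundsAtTwoK_of_kolyvaginConjecture_of_manin
    (hGZ : ∀ (N : ℕ) [NeZero N] (W : WeierstrassCurve ℚ) (K : Type) [Field K] [NumberField K], gross_zagier N W K)
    (hGZK : rank_eq_analyticRank_of_analyticRank_le_one) (hnf : exists_isNewformOf)
    (hHL : HoffsteinLuo1997_exists_twist_L_one_ne_zero) (hMilneC : Milne1972.bsdQuotient_baseChange_quadratic_anyModel)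
    (hMan : S_manin)
    (hKU : ∀ (W : WeierstrassCurve ℚ) [W.IsElliptic] [W.IsGloballyMinimal] [NeZero (W.conductorNorm ℤ)], ¬ W.HasCM →
      ∀ (K : Type) [Field K] [NumberField K], IsImaginaryQuadratic K → Odd (NumberField.discr K) →
        NumberField.discr K ≠ -3 → SatisfiesHeegnerHypothesis (W.conductorNorm ℤ) K →
        ¬ IsSquare ((NumberField.discr K : ℚ) * -|W.Δ|) → ¬ IsSquare ((NumberField.discr K : ℚ) * (-(2 * |W.Δ|))) →
        (∀ n : ℕ, 0 < n → W.HasSurjectiveModNGaloisRep ((2 : ℤ) ^ n)) →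
        ∀ (Dt : ModularParametrizationData W (W.conductorNorm ℤ)) (β : ℤ) (ι : K →+* ℂ) (d₁ : KolyvaginHeegnerData Dt β ι 1),
          ¬ IsOfFinAddOrder d₁.derivedPoint → ∀ (M₀ : ℕ),
          (¬ ∃ Q : (W.baseChange (ringClassField K ι 1)).toAffine.Point, ((2 ^ (M₀ + 1) : ℕ) : ℤ) • Q = d₁.derivedPoint) →
          Nat.card (AddCommGroup.primaryComponent (W.baseChange K).sha 2) ∣ 2 ^ (2 * M₀))
    (hKL : ∀ (W : WeierstrassCurve ℚ) [W.IsElliptic] [W.IsGloballyMinimal] [NeZero (W.conductorNorm ℤ)], ¬ W.HasCM →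
      ∀ (K : Type) [Field K] [NumberField K], IsImaginaryQuadratic K → Odd (NumberField.discr K) →
        NumberField.discr K ≠ -3 → SatisfiesHeegnerHypothesis (W.conductorNorm ℤ) K →
        ¬ IsSquare ((NumberField.discr K : ℚ) * -|W.Δ|) → ¬ IsSquare ((NumberField.discr K : ℚ) * (-(2 * |W.Δ|))) →
        (∀ n : ℕ, 0 < n → W.HasSurjectiveModNGaloisRep ((2 : ℤ) ^ n)) →
        ∀ (Dt : ModularParametrizationData W (W.conductorNorm ℤ)) (β : ℤ) (ι : K →+* ℂ) (d₁ : KolyvaginHeegnerData Dt β ι 1),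
          ¬ IsOfFinAddOrder d₁.derivedPoint → ∀ (M₀ : ℕ),
          (∃ Q : (W.baseChange (ringClassField K ι 1)).toAffine.Point, ((2 ^ M₀ : ℕ) : ℤ) • Q = d₁.derivedPoint) →
          ∀ (n : ℕ) (d : KolyvaginHeegnerData Dt β ι n), Squarefree n →
            (∀ ℓ ∈ n.primeFactors, Zhang2014.IsKolyvaginPrime (W.conductorNorm ℤ) W K 2 ℓ) →
            (¬ ∃ Q : (W.baseChange (ringClassField K ι n)).toAffine.Point, (2 : ℤ) • Q = d.derivedPoint) →
            2 ^ (2 * M₀) ∣ Nat.card (AddCommGroup.primaryComponent (W.baseChange K).sha 2))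
    (hKC : ∀ (W : WeierstrassCurve ℚ) [W.IsElliptic] [W.IsGloballyMinimal] [NeZero (W.conductorNorm ℤ)],
      ¬ W.HasCM → (∀ n : ℕ, W.HasSurjectiveModNGaloisRep ((2 ^ n : ℕ) : ℤ)) → Odd W.tamagawaProduct → W.analyticRank = 1 →
      ∀ (K : Type) [Field K] [NumberField K], IsImaginaryQuadratic K → Odd (NumberField.discr K) →
        NumberField.discr K ≠ -3 → SatisfiesHeegnerHypothesis (W.conductorNorm ℤ) K →
        ¬ IsSquare ((NumberField.discr K : ℚ) * -|W.Δ|) → ¬ IsSquare ((NumberField.discr K : ℚ) * (-(2 * |W.Δ|))) →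
        ∀ (Dt : ModularParametrizationData W (W.conductorNorm ℤ)) (β : ℤ) (ι : K →+* ℂ) (d₁ : KolyvaginHeegnerData Dt β ι 1),
          Odd Dt.c → ¬ IsOfFinAddOrder d₁.derivedPoint →
          ∃ (n : ℕ) (d : KolyvaginHeegnerData Dt β ι n), Squarefree n ∧
            (∀ ℓ ∈ n.primeFactors, Zhang2014.IsKolyvaginPrime (W.conductorNorm ℤ) W K 2 ℓ) ∧
            ¬ ∃ Q : (W.baseChange (ringClassField K ι n)).toAffine.Point, (2 : ℤ) • Q = d.derivedPoint)
    (hZ : S_rankZeroTwin) :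
    ∀ (W : WeierstrassCurve ℚ) [W.IsElliptic] [W.IsGloballyMinimal], ¬ W.HasCM →
      (∀ n : ℕ, W.HasSurjectiveModNGaloisRep ((2 ^ n : ℕ) : ℤ)) → Odd W.torsionOrder → Odd W.tamagawaProduct →
      W.analyticRank = 1 → MissingLowerBoundAt W 2 := by
  intro W _ _ hCM hsurj hT hc hr
  haveI hN : NeZero (W.conductorNorm ℤ) := ⟨(W.conductorNorm_pos_holds).ne'⟩
  have hmod : hasEntireLFunction_rat := hasEntireLFunction_rat_of_exists_isNewformOf hnf
  obtain ⟨K, _iF, _iN, hK, hodd, h3, hH, hsq1, hsq2, Dt, β, ι, d₁, M₀, hcM, hy, hdiv, hndiv⟩ :=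
    exists_oddConstant_kolyvaginDoorDatum_of_onSlice hGZ hnf hHL hMan W hT hr
  have hsurj' := hasSurjectiveModNGaloisRep_two_pow_of_tower W hsurj
  -- Kolyvagin's conjecture at `2`: a `2`-indivisible derived point in the frame of the odd-constant datum
  obtain ⟨n, d, hn, hKoly, hPn⟩ := hKC W hCM hsurj hc hr K hK hodd h3 hH hsq1 hsq2 Dt β ι d₁ hcM hy
  -- the two stubs pin the order of `Ш(E_K)[2^∞]`
  have hup := hKU W hCM K hK hodd h3 hH hsq1 hsq2 hsurj' Dt β ι d₁ hy M₀ hndiv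
  have hlow := hKL W hCM K hK hodd h3 hH hsq1 hsq2 hsurj' Dt β ι d₁ hy M₀ hdiv n d hn hKoly hPn
  have hcard : Nat.card (AddCommGroup.primaryComponent (W.baseChange K).sha 2) = 2 ^ (2 * M₀) := Nat.dvd_antisymm hup hlow
  have hc2 : ¬ (2 : ℤ) ∣ Dt.c := fun h => (Int.not_even_iff_odd.mpr hcM) (even_iff_two_dvd.mpr h)
  have hvc : padicValInt 2 Dt.c = 0 := padicValInt.eq_zero_of_not_dvd hc2
  have hshaL : 2 * (M₀ : ℤ) ≤ (padicValNat 2 (Nat.card (AddCommGroup.primaryComponent (W.baseChange K).sha 2)) : ℤ) +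
      2 * padicValInt 2 Dt.c := by
    rw [hcard, padicValNat.prime_pow, hvc]; push_cast; omega
  exact missingLowerBoundAt_two_of_shaLowerC_at hGZ hGZK hmod hMilneC hZ W hCM hsurj hc hr K hK hodd h3 hH Dt β ι d₁ hy M₀ hdiv
    hndiv hshaL

/-- **AN-28c-L `DoorIndexLawLowerCAtTwo` — the conclusion of the skeleton's `stub_doorLowerC` — from the two registered stubs of
22137 (`hKU`, `hKL`), Kolyvagin's conjecture at `2` on the slice's doors (`hKC`) and `S_manin`**, modulo PRINT (Gross–Zagier,
Kolyvagin, GZK, modularity as a newform, Hoffstein–Luo 1997, Milne 1972) and `S_rankZeroTwin`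
(`doorIndexLawLowerCAtTwo_of_missingLowerBoundAt_onSlice` on the slice-level statement).  Conditional by design; BSD is not proved by
this. [cite: GrossLMS1991, §2 Conj. (2.2) and §4] [cite: McCallumLMS1991, §5] [cite: Milne1972ArithmeticAV, §1 Thm. 1] -/
theorem doorIndexLawLowerCAtTwo_of_kolyvaginBoundsAtTwoK_of_kolyvaginConjecture_of_manin
    (hGZ : ∀ (N : ℕ) [NeZero N] (W : WeierstrassCurve ℚ) (K : Type) [Field K] [NumberField K], gross_zagier N W K)
    (hKo : ∀ (N : ℕ) [NeZero N] (W : WeierstrassCurve ℚ) (K : Type) [Field K] [NumberField K], kolyvagin N W K)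
    (hGZK : rank_eq_analyticRank_of_analyticRank_le_one) (hnf : exists_isNewformOf)
    (hHL : HoffsteinLuo1997_exists_twist_L_one_ne_zero) (hMilneC : Milne1972.bsdQuotient_baseChange_quadratic_anyModel)
    (hMan : S_manin)
    (hKU : ∀ (W : WeierstrassCurve ℚ) [W.IsElliptic] [W.IsGloballyMinimal] [NeZero (W.conductorNorm ℤ)], ¬ W.HasCM →
      ∀ (K : Type) [Field K] [NumberField K], IsImaginaryQuadratic K → Odd (NumberField.discr K) →
        NumberField.discr K ≠ -3 → SatisfiesHeegnerHypothesis (W.conductorNorm ℤ) K →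
        ¬ IsSquare ((NumberField.discr K : ℚ) * -|W.Δ|) → ¬ IsSquare ((NumberField.discr K : ℚ) * (-(2 * |W.Δ|))) →
        (∀ n : ℕ, 0 < n → W.HasSurjectiveModNGaloisRep ((2 : ℤ) ^ n)) →
        ∀ (Dt : ModularParametrizationData W (W.conductorNorm ℤ)) (β : ℤ) (ι : K →+* ℂ) (d₁ : KolyvaginHeegnerData Dt β ι 1),
          ¬ IsOfFinAddOrder d₁.derivedPoint → ∀ (M₀ : ℕ),
          (¬ ∃ Q : (W.baseChange (ringClassField K ι 1)).toAffine.Point, ((2 ^ (M₀ + 1) : ℕ) : ℤ) • Q = d₁.derivedPoint) →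
          Nat.card (AddCommGroup.primaryComponent (W.baseChange K).sha 2) ∣ 2 ^ (2 * M₀))
    (hKL : ∀ (W : WeierstrassCurve ℚ) [W.IsElliptic] [W.IsGloballyMinimal] [NeZero (W.conductorNorm ℤ)], ¬ W.HasCM →
      ∀ (K : Type) [Field K] [NumberField K], IsImaginaryQuadratic K → Odd (NumberField.discr K) →
        NumberField.discr K ≠ -3 → SatisfiesHeegnerHypothesis (W.conductorNorm ℤ) K →
        ¬ IsSquare ((NumberField.discr K : ℚ) * -|W.Δ|) → ¬ IsSquare ((NumberField.discr K : ℚ) * (-(2 * |W.Δ|))) →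
        (∀ n : ℕ, 0 < n → W.HasSurjectiveModNGaloisRep ((2 : ℤ) ^ n)) →
        ∀ (Dt : ModularParametrizationData W (W.conductorNorm ℤ)) (β : ℤ) (ι : K →+* ℂ) (d₁ : KolyvaginHeegnerData Dt β ι 1),
          ¬ IsOfFinAddOrder d₁.derivedPoint → ∀ (M₀ : ℕ),
          (∃ Q : (W.baseChange (ringClassField K ι 1)).toAffine.Point, ((2 ^ M₀ : ℕ) : ℤ) • Q = d₁.derivedPoint) →
          ∀ (n : ℕ) (d : KolyvaginHeegnerData Dt β ι n), Squarefree n →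
            (∀ ℓ ∈ n.primeFactors, Zhang2014.IsKolyvaginPrime (W.conductorNorm ℤ) W K 2 ℓ) →
            (¬ ∃ Q : (W.baseChange (ringClassField K ι n)).toAffine.Point, (2 : ℤ) • Q = d.derivedPoint) →
            2 ^ (2 * M₀) ∣ Nat.card (AddCommGroup.primaryComponent (W.baseChange K).sha 2))
    (hKC : ∀ (W : WeierstrassCurve ℚ) [W.IsElliptic] [W.IsGloballyMinimal] [NeZero (W.conductorNorm ℤ)],
      ¬ W.HasCM → (∀ n : ℕ, W.HasSurjectiveModNGaloisRep ((2 ^ n : ℕ) : ℤ)) → Odd W.tamagawaProduct → W.analyticRank = 1 →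
      ∀ (K : Type) [Field K] [NumberField K], IsImaginaryQuadratic K → Odd (NumberField.discr K) →
        NumberField.discr K ≠ -3 → SatisfiesHeegnerHypothesis (W.conductorNorm ℤ) K →
        ¬ IsSquare ((NumberField.discr K : ℚ) * -|W.Δ|) → ¬ IsSquare ((NumberField.discr K : ℚ) * (-(2 * |W.Δ|))) →
        ∀ (Dt : ModularParametrizationData W (W.conductorNorm ℤ)) (β : ℤ) (ι : K →+* ℂ) (d₁ : KolyvaginHeegnerData Dt β ι 1),
          Odd Dt.c → ¬ IsOfFinAddOrder d₁.derivedPoint →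
          ∃ (n : ℕ) (d : KolyvaginHeegnerData Dt β ι n), Squarefree n ∧
            (∀ ℓ ∈ n.primeFactors, Zhang2014.IsKolyvaginPrime (W.conductorNorm ℤ) W K 2 ℓ) ∧
            ¬ ∃ Q : (W.baseChange (ringClassField K ι n)).toAffine.Point, (2 : ℤ) • Q = d.derivedPoint)
    (hZ : S_rankZeroTwin) : DoorIndexLawLowerCAtTwo :=
  doorIndexLawLowerCAtTwo_of_missingLowerBoundAt_onSlice hGZ hKo hnf hHL
    (missingLowerBoundAt_two_onSlice_of_kolyvaginBoundsAtTwoK_of_kolyvaginConjecture_of_manin hGZ hGZK hnf hHL hMilneC hMan hKU hKL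
      hKC hZ) hZ

/-! ### §3 The crux by name from the two stubs of 22137, Kolyvagin's conjecture at `2`, Manin, PRINT and the rank-`0` cruxes -/

/-- **Crux `RankOneAtTwoBigImageOddLocal` BY NAME from route GenusKolyvaginAtTwo's two REGISTERED stubs of `KolyvaginExactAtTwo`
(`hKU`, `hKL`, verbatim), Kolyvagin's conjecture at `2` on the slice's doors (`hKC`), the odd-constant supply `S_manin`, PRINT
(Gross–Zagier, Kolyvagin, GZK, modularity as a newform, Hoffstein–Luo 1997, Milne 1972) and THIS ROUTE'S four rank-`0` cruxes at `2`
BY NAME** — through the v8.6 composition `rankOneAtTwoBigImageOddLocal_of_oneDoorAnalyticC_halves` on §1 and §2.  Conditional by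
design; BSD is not proved by this. [cite: GrossLMS1991, Thm. 1.3, §2 Conj. (2.2) and §4] [cite: McCallumLMS1991, §5]
[cite: Milne1972ArithmeticAV, §1 Thm. 1] -/
theorem rankOneAtTwoBigImageOddLocal_of_kolyvaginBoundsAtTwoK_of_kolyvaginConjecture_of_manin
    (hGZ : ∀ (N : ℕ) [NeZero N] (W : WeierstrassCurve ℚ) (K : Type) [Field K] [NumberField K], gross_zagier N W K)
    (hKo : ∀ (N : ℕ) [NeZero N] (W : WeierstrassCurve ℚ) (K : Type) [Field K] [NumberField K], kolyvagin N W K)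
    (hGZK : rank_eq_analyticRank_of_analyticRank_le_one) (hnf : exists_isNewformOf)
    (hHL : HoffsteinLuo1997_exists_twist_L_one_ne_zero) (hMilneC : Milne1972.bsdQuotient_baseChange_quadratic_anyModel)
    (hMan : S_manin)
    (hKU : ∀ (W : WeierstrassCurve ℚ) [W.IsElliptic] [W.IsGloballyMinimal] [NeZero (W.conductorNorm ℤ)], ¬ W.HasCM →
      ∀ (K : Type) [Field K] [NumberField K], IsImaginaryQuadratic K → Odd (NumberField.discr K) →
        NumberField.discr K ≠ -3 → SatisfiesHeegnerHypothesis (W.conductorNorm ℤ) K →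
        ¬ IsSquare ((NumberField.discr K : ℚ) * -|W.Δ|) → ¬ IsSquare ((NumberField.discr K : ℚ) * (-(2 * |W.Δ|))) →
        (∀ n : ℕ, 0 < n → W.HasSurjectiveModNGaloisRep ((2 : ℤ) ^ n)) →
        ∀ (Dt : ModularParametrizationData W (W.conductorNorm ℤ)) (β : ℤ) (ι : K →+* ℂ) (d₁ : KolyvaginHeegnerData Dt β ι 1),
          ¬ IsOfFinAddOrder d₁.derivedPoint → ∀ (M₀ : ℕ),
          (¬ ∃ Q : (W.baseChange (ringClassField K ι 1)).toAffine.Point, ((2 ^ (M₀ + 1) : ℕ) : ℤ) • Q = d₁.derivedPoint) →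
          Nat.card (AddCommGroup.primaryComponent (W.baseChange K).sha 2) ∣ 2 ^ (2 * M₀))
    (hKL : ∀ (W : WeierstrassCurve ℚ) [W.IsElliptic] [W.IsGloballyMinimal] [NeZero (W.conductorNorm ℤ)], ¬ W.HasCM →
      ∀ (K : Type) [Field K] [NumberField K], IsImaginaryQuadratic K → Odd (NumberField.discr K) →
        NumberField.discr K ≠ -3 → SatisfiesHeegnerHypothesis (W.conductorNorm ℤ) K →
        ¬ IsSquare ((NumberField.discr K : ℚ) * -|W.Δ|) → ¬ IsSquare ((NumberField.discr K : ℚ) * (-(2 * |W.Δ|))) →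
        (∀ n : ℕ, 0 < n → W.HasSurjectiveModNGaloisRep ((2 : ℤ) ^ n)) →
        ∀ (Dt : ModularParametrizationData W (W.conductorNorm ℤ)) (β : ℤ) (ι : K →+* ℂ) (d₁ : KolyvaginHeegnerData Dt β ι 1),
          ¬ IsOfFinAddOrder d₁.derivedPoint → ∀ (M₀ : ℕ),
          (∃ Q : (W.baseChange (ringClassField K ι 1)).toAffine.Point, ((2 ^ M₀ : ℕ) : ℤ) • Q = d₁.derivedPoint) →
          ∀ (n : ℕ) (d : KolyvaginHeegnerData Dt β ι n), Squarefree n →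
            (∀ ℓ ∈ n.primeFactors, Zhang2014.IsKolyvaginPrime (W.conductorNorm ℤ) W K 2 ℓ) →
            (¬ ∃ Q : (W.baseChange (ringClassField K ι n)).toAffine.Point, (2 : ℤ) • Q = d.derivedPoint) →
            2 ^ (2 * M₀) ∣ Nat.card (AddCommGroup.primaryComponent (W.baseChange K).sha 2))
    (hKC : ∀ (W : WeierstrassCurve ℚ) [W.IsElliptic] [W.IsGloballyMinimal] [NeZero (W.conductorNorm ℤ)],
      ¬ W.HasCM → (∀ n : ℕ, W.HasSurjectiveModNGaloisRep ((2 ^ n : ℕ) : ℤ)) → Odd W.tamagawaProduct → W.analyticRank = 1 →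
      ∀ (K : Type) [Field K] [NumberField K], IsImaginaryQuadratic K → Odd (NumberField.discr K) →
        NumberField.discr K ≠ -3 → SatisfiesHeegnerHypothesis (W.conductorNorm ℤ) K →
        ¬ IsSquare ((NumberField.discr K : ℚ) * -|W.Δ|) → ¬ IsSquare ((NumberField.discr K : ℚ) * (-(2 * |W.Δ|))) →
        ∀ (Dt : ModularParametrizationData W (W.conductorNorm ℤ)) (β : ℤ) (ι : K →+* ℂ) (d₁ : KolyvaginHeegnerData Dt β ι 1),
          Odd Dt.c → ¬ IsOfFinAddOrder d₁.derivedPoint →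
          ∃ (n : ℕ) (d : KolyvaginHeegnerData Dt β ι n), Squarefree n ∧
            (∀ ℓ ∈ n.primeFactors, Zhang2014.IsKolyvaginPrime (W.conductorNorm ℤ) W K 2 ℓ) ∧
            ¬ ∃ Q : (W.baseChange (ringClassField K ι n)).toAffine.Point, (2 : ℤ) • Q = d.derivedPoint)
    (hR0 : GoodOrdinaryRankZeroAtTwo ∧ MultiplicativeRankZeroAtTwo ∧ SupersingularRankZeroAtTwo ∧ AdditiveRankZeroAtTwo) :
    RankOneAtTwoBigImageOddLocal :=
  have hZ : S_rankZeroTwin := rankZeroTwin_of_rankZero_cruxes hR0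
  rankOneAtTwoBigImageOddLocal_of_oneDoorAnalyticC_halves hGZ hKo hnf hHL
    (doorIndexLawUpperCAtTwo_of_kolyvaginUpperBoundAtTwoK_of_manin hGZ hKo hGZK hnf hHL hMilneC hMan hKU hZ)
    (doorIndexLawLowerCAtTwo_of_kolyvaginBoundsAtTwoK_of_kolyvaginConjecture_of_manin hGZ hKo hGZK hnf hHL hMilneC hMan hKU hKL hKC
      hZ) hR0

end Summit.BirchSwinnertonDyer.BirchSwinnertonDyer.Theorems.RankOneAtTwoOneDoor

end
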